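import Summits.ResolutionOfSingularities.ResolutionOfSingularities.Theorems.ValuativeTorsorToLurelFfiniteTower
import Summits.ResolutionOfSingularities.ResolutionOfSingularities.Theorems.ValuativeTorsorToLurelFfiniteAbsorb
import Mathlib.FieldTheory.IntermediateField.Adjoin.Basic
import Mathlib.RingTheory.Adjoin.FG
import Mathlib.Algebra.CharP.Lemmas

/-!
# `Valuative.TorsorToLurel`: tower and absorb over the ground field `k`

Route `ResolutionOfSingularities/Valuative`, support item `TorsorToLurel`
(stmt-ResolutionOfSingularities-10968). Helper file for the transfer line
`TorsorToLurelFfinite → TorsorToLurel`.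

`stub_ttlTowerAbsorb`: given a chart `A₀ ⊆ O` over `k` (finitely generated, regular at the
centre `𝔪_O ∩ A₀`) with `R ^ {p^m} ⊆ A₀` and `g ^ {p^m} ∈ k(A₀)` for every `g` in a finite set
`G ⊆ O` of field generators of `K/k`, there is a chart `A ⊇ R` over `k` with `Frac A = K`.
Proof (Temkin 2013, Rem. 1.3.5 (ii), re-run over `k` itself): climb the finite purely
inseparable tower `k(A₀) ⊆ K` one `p`-th root at a time with the torsor hypothesis
(`torsor_roots`) to get a chart `A₁ ⊇ A₀` with `k(A₁) = K`; then `A := k[A₁, R]` has all its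
`p^m`-th powers in `A₁` (Frobenius is a ring map), so it is regular at the centre by normality of
the regular local ring `(A₁)_{𝔪_O ∩ A₁}` (`isRegularLocalRing_centre_of_pow_mem`).
-/

noncomputable section

set_option linter.dupNamespace false -- mandated namespace of this single-conjunct summit

open IsLocalRing

namespace Summit.ResolutionOfSingularities.ResolutionOfSingularities.Theorems

/-- **Tower and absorb**: given a chart `A₀ ⊆ O` over `k` (finitely generated, regular at the
centre) such that `R ^ {p^m} ⊆ A₀` and `G ^ {p^m} ⊆ k(A₀)` for a finite set `G ⊆ O` of field
generators, the torsor hypothesis climbs `k(A₀) ⊆ K` (`torsor_roots`) and normality absorbs `R`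
(`isRegularLocalRing_centre_of_pow_mem`). -/
theorem stub_ttlTowerAbsorb (p : ℕ) [Fact p.Prime]
    (hT : ∀ (k K : Type) [Field k] [CharP k p] [Field K] [Algebra k K] (O : ValuationSubring K)
      (A₀ : Subalgebra k K) (h₀ : A₀.toSubring ≤ O.toSubring) (t : K), A₀.FG → t ^ p ∈ A₀ →
      IsFractionRing (Algebra.adjoin k (insert t (A₀ : Set K))) K →
      IsRegularLocalRing (Localization.AtPrime
        (Ideal.comap (Subring.inclusion h₀) (maximalIdeal O))) →
      ∃ (A : Subalgebra k K) (h : A.toSubring ≤ O.toSubring), A₀ ≤ A ∧ t ∈ A ∧ A.FG ∧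
        IsFractionRing A K ∧
        IsRegularLocalRing (Localization.AtPrime
          (Ideal.comap (Subring.inclusion h) (maximalIdeal O))))
    (k K : Type) [Field k] [CharP k p] [Field K] [Algebra k K] (O : ValuationSubring K)
    (R : Subalgebra k K) (hRfg : R.FG) (hRO : R.toSubring ≤ O.toSubring)
    (G : Finset K) (hGO : ∀ g ∈ G, g ∈ O) (hGtop : IntermediateField.adjoin k (G : Set K) = ⊤)
    (m : ℕ) (A₀ : Subalgebra k K) (h₀ : A₀.toSubring ≤ O.toSubring) (hA₀fg : A₀.FG)
    (hreg₀ : IsRegularLocalRing (Localization.AtPrime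
      (Ideal.comap (Subring.inclusion h₀) (maximalIdeal O))))
    (hRpow : ∀ r ∈ R, r ^ p ^ m ∈ A₀)
    (hGpow : ∀ g ∈ G, g ^ p ^ m ∈ IntermediateField.adjoin k (A₀ : Set K)) :
    ∃ (A : Subalgebra k K) (h : A.toSubring ≤ O.toSubring), R ≤ A ∧ A.FG ∧ IsFractionRing A K ∧
      IsRegularLocalRing (Localization.AtPrime
        (Ideal.comap (Subring.inclusion h) (maximalIdeal O))) := by
  classical
  have hp : p.Prime := Fact.out
  -- Step 1: climb the `p`-radical tower `k(A₀) ⊆ K` with the torsor hypothesis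
  obtain ⟨A₁, h₁, hle₁, hfg₁, hreg₁, hadj₁⟩ :=
    torsor_roots hT O m G A₀ h₀ hA₀fg hreg₀ hGO hGpow
  have htop : IntermediateField.adjoin k (A₁ : Set K) = ⊤ := by
    refine eq_top_iff.mpr ?_
    rw [← hGtop, hadj₁]
    exact IntermediateField.adjoin.mono k _ _ Set.subset_union_right
  haveI hA₁fr : IsFractionRing A₁.toSubring K := by
    refine IsFractionRing.of_field A₁.toSubring K fun z => ?_
    have hz : z ∈ IntermediateField.adjoin k (A₁ : Set K) := by
      rw [htop]; exact IntermediateField.mem_top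
    obtain ⟨r, hr, s, hs, rfl⟩ := IntermediateField.mem_adjoin_iff_div.mp hz
    rw [Algebra.adjoin_eq] at hr hs
    exact ⟨⟨r, hr⟩, ⟨s, hs⟩, rfl⟩
  -- Step 2: the chart `A := k[A₁, R]`
  obtain ⟨S₁, hS₁⟩ := hfg₁
  obtain ⟨SR, hSR⟩ := hRfg
  let A : Subalgebra k K := Algebra.adjoin k ((S₁ ∪ SR : Finset K) : Set K)
  have hS₁A₁ : (S₁ : Set K) ⊆ A₁ := by rw [← hS₁]; exact Algebra.subset_adjoin
  have hSRR : (SR : Set K) ⊆ R := by rw [← hSR]; exact Algebra.subset_adjoin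
  have hA₁A' : A₁ ≤ A := by
    rw [← hS₁]
    exact Algebra.adjoin_mono (by rw [Finset.coe_union]; exact Set.subset_union_left)
  have hRA : R ≤ A := by
    rw [← hSR]
    exact Algebra.adjoin_mono (by rw [Finset.coe_union]; exact Set.subset_union_right)
  have hA₁A : A₁.toSubring ≤ A.toSubring := fun x hx => hA₁A' hx
  have hO : ∀ c : k, algebraMap k K c ∈ O := fun c => h₀ (A₀.algebraMap_mem c)
  let Oalg : Subalgebra k K := { O.toSubring with algebraMap_mem' := hO }
  have hAO : A.toSubring ≤ O.toSubring := by
    have hle : A ≤ Oalg := Algebra.adjoin_le (by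
      rw [Finset.coe_union]
      rintro x (hx | hx)
      · exact h₁ (hS₁A₁ hx)
      · exact hRO (hSRR hx))
    exact fun x hx => hle hx
  -- Step 3: every element of `A` has its `p^m`-th power in `A₁`
  haveI : CharP K p := (Algebra.charP_iff k K p).mp inferInstance
  have hpow : ∀ x ∈ A.toSubring, x ^ p ^ m ∈ A₁.toSubring := by
    let C : Subalgebra k K :=
      { A₁.toSubring.comap (iterateFrobenius K p m) with
        algebraMap_mem' := fun c => by
          change iterateFrobenius K p m (algebraMap k K c) ∈ A₁.toSubring
          rw [iterateFrobenius_def, ← map_pow]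
          exact A₁.algebraMap_mem _ }
    have hAC : A ≤ C := Algebra.adjoin_le (by
      rw [Finset.coe_union]
      rintro x (hx | hx)
      · change iterateFrobenius K p m x ∈ A₁.toSubring
        rw [iterateFrobenius_def]
        exact pow_mem (hS₁A₁ hx) _
      · change iterateFrobenius K p m x ∈ A₁.toSubring
        rw [iterateFrobenius_def]
        exact hle₁ (hRpow x (hSRR hx)))
    intro x hx
    have := hAC hx
    change iterateFrobenius K p m x ∈ A₁.toSubring at this
    rwa [iterateFrobenius_def] at this
  -- Step 4: absorb by normality of the regular centre
  have hregA := isRegularLocalRing_centre_of_pow_mem O A₁.toSubring A.toSubring hA₁A h₁ hAO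
    (pow_pos hp.pos m) hpow hreg₁
  -- Step 5: conclude
  refine ⟨A, hAO, hRA, ⟨_, rfl⟩, ?_, hregA⟩
  refine IsFractionRing.of_field A K fun z => ?_
  obtain ⟨a, b, -, rfl⟩ := IsFractionRing.div_surjective (A := A₁.toSubring) z
  exact ⟨⟨a, hA₁A a.2⟩, ⟨b, hA₁A b.2⟩, rfl⟩

end Summit.ResolutionOfSingularities.ResolutionOfSingularities.Theorems

end
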